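import Summits.Ventures.LatticeQCDFlow.Exactness.Phi4HMCNoSpectralGapN
import Summits.Ventures.LatticeQCDFlow.Exactness.RandomisedHMC
import HarnessLib

/-!
# Randomising the trajectory LENGTH does not restore the spectral gap of fixed-step HMC for lattice φ⁴

HONEST FRAMING: exact (Metropolis-corrected) sampling algorithms for lattice gauge theory;
figures of merit are autocorrelation/cost numbers at stated couplings and volumes; no
continuum-physics claim.  (SCALAR calibration rung S0-A: not a gauge result.)

Venture `LatticeQCDFlow` (cell pub-lqcd), topic `Exactness`; FANOUT row 2 (`s0-phi4`, HMC arm).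
NEW WORK of the cell, composing `Exactness/Phi4HMCTailRejectionN.lean` / `Phi4HMCNoSpectralGapN.lean`
(every fixed trajectory length `N ≥ 1`) with the randomised-length update
`hmcOpRandom J λ δ S w = Σ_{N∈S} w_N · hmcOpPhi4 J λ δ N` of `Exactness/RandomisedHMC.lean` (Mackenzie's
randomisation, named there; gen-15 proved it removes the free-field resonances from the
magnetisation floor).  Nothing is cited as a fact.

## What is proved (`Λ = Fin (n+1)`, `λ > 0`, real `J`, `δ > 0`; `S` a finite set of POSITIVE lengths,
`w ≥ 0` with `Σ_{N∈S} w_N = 1`; `χ_t` the indicator of `A_t = {t ≤ φ_x ≤ 2t ∀x}`, `g_t = χ_t − ⟨χ_t⟩`)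

* `hmcPhi4_accept_le_of_mem_box_finset` — for every `ε > 0` one threshold `T` serves all `N ∈ S`:
  for `t ≥ T`, from every `φ ∈ A_t` each `N`-step update is accepted with probability `≤ ε`;
* **`hmcRandom_dirichlet_indicator_le`** — the Dirichlet form of the randomised update is the
  `w`-average of the fixed-length ones, so for a `0/1` indicator rarely left by every `K_N` (`N ∈ S`)
  `∫ g² e^{−S} − ∫ g (K̄ g) e^{−S} ≤ ε ∫ χ e^{−S}`;
* **`hmcRandom_no_spectral_gap`** — for every `ε > 0` there is `t ≥ 1` with `∫ g_t² e^{−S} > 0` and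
  `ρ_{g_t}(1) = ∫ g_t (K̄ g_t) e^{−S} / ∫ g_t² e^{−S} ≥ 1 − ε`: the randomised-length exact HMC has NO
  `L²(e^{−S})` SPECTRAL GAP either, at every fixed step size.

Reading (no numerics implied): randomising the number of leapfrog steps cures resonances
(`FreeFieldRandomisedHMCCSD`) but not the tail instability of the fixed-step leapfrog — every length in
the support overshoots from far enough out; uniform guarantees need the STEP SIZE to adapt (or a
tail-stable integrator).  NOT CLAIMED: lengths drawn from an infinite-support law (a uniform threshold
need not exist); `0 ∈ S` (the zero-length update never moves and trivially fits, but is excluded for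
brevity); the pqp integrator; `λ = 0`.
-/

namespace Summit.Ventures.LatticeQCDFlow.Exactness

open Real MeasureTheory Filter Finset
open Summit.Ventures.LatticeQCDFlow.Scoring

section RandomNoGap

variable {n : ℕ}

/-- **One threshold for finitely many lengths**: for every finite set `S` of positive lengths and every
`ε > 0` there is `T ≥ 1` such that for all `N ∈ S`, all `t ≥ T` and every `φ ∈ A_t`, the `N`-step
update is accepted with probability at most `ε`. -/
theorem hmcPhi4_accept_le_of_mem_box_finset {lam δ : ℝ} (hlam : 0 < lam) (hδ : 0 < δ)
    (J : Fin (n + 1) → Fin (n + 1) → ℝ) {ε : ℝ} (hε : 0 < ε) (S : Finset ℕ) (hS : ∀ N ∈ S, 1 ≤ N) :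
    ∃ T : ℝ, 1 ≤ T ∧ ∀ N ∈ S, ∀ t : ℝ, T ≤ t → ∀ φ : Fin (n + 1) → ℝ,
      (∀ y, t ≤ φ y ∧ φ y ≤ 2 * t) →
      (∫ p, involAccept (phi4HmcEnergy J lam) (hmcProposal J lam δ N) (φ, p) * momentumWeight p)
          / momentumZ n ≤ ε := by
  classical
  induction S using Finset.induction_on with
  | empty => exact ⟨1, le_rfl, fun N hN => absurd hN (Finset.notMem_empty N)⟩
  | @insert N₀ S hN₀ ih =>
    obtain ⟨T, hT, hall⟩ := ih fun N hN => hS N (Finset.mem_insert_of_mem hN)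
    obtain ⟨T₀, hT₀, h₀⟩ := hmcPhi4_accept_le_of_mem_box_eventually hlam hδ J N₀
      (hS N₀ (Finset.mem_insert_self N₀ S)) hε
    refine ⟨max T T₀, le_trans hT (le_max_left _ _), fun N hN t ht φ hφ => ?_⟩
    rcases Finset.mem_insert.mp hN with h | h
    · subst h
      exact h₀ t (le_trans (le_max_right _ _) ht) φ hφ
    · exact hall N h t (le_trans (le_max_left _ _) ht) φ hφ

/-- **The Dirichlet form of the randomised-length update at a rarely-left indicator.**  `λ > 0`, real
`J`; `S` finite, `w ≥ 0`, `Σ_{N∈S} w_N = 1`; `χ` bounded measurable with values in `{0, 1}` such that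
from every configuration with `χ = 1` EACH `N`-step update (`N ∈ S`) is accepted with probability at
most `ε`; `g = χ − c`.  Then `∫ g² e^{−S} − ∫ g (K̄ g) e^{−S} ≤ ε ∫ χ e^{−S}`,
`K̄ = hmcOpRandom J λ δ S w`. -/
theorem hmcRandom_dirichlet_indicator_le {lam : ℝ} (hlam : 0 < lam) (J : Fin (n + 1) → Fin (n + 1) → ℝ)
    (δ : ℝ) (S : Finset ℕ) {w : ℕ → ℝ} (hw0 : ∀ N, 0 ≤ w N) (hw1 : ∑ N ∈ S, w N = 1)
    {χ : (Fin (n + 1) → ℝ) → ℝ} (hχ : BddObs χ) (h01 : ∀ φ, χ φ = 0 ∨ χ φ = 1) {ε : ℝ}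
    (hacc : ∀ N ∈ S, ∀ φ, χ φ = 1 →
      (∫ p, involAccept (phi4HmcEnergy J lam) (hmcProposal J lam δ N) (φ, p) * momentumWeight p)
          / momentumZ n ≤ ε) (c : ℝ) :
    (∫ φ, (χ φ - c) ^ 2 * gibbsWeight J lam φ)
        - ∫ φ, (χ φ - c) * hmcOpRandom J lam δ S w (fun ψ => χ ψ - c) φ * gibbsWeight J lam φ
      ≤ ε * ∫ φ, χ φ * gibbsWeight J lam φ := by
  have hco := latticePhi4Action_coercive hlam J
  have h1 : BddObs (fun _ : Fin (n + 1) → ℝ => (1 : ℝ)) := bddObs_const 1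
  have hg : BddObs (fun ψ : Fin (n + 1) → ℝ => χ ψ - c) := by
    have h := bddObs_add_mul hχ h1 (-c)
    have e : (fun φ : Fin (n + 1) → ℝ => χ φ + -c * (1 : ℝ)) = fun ψ => χ ψ - c := by
      funext s; ring
    rw [e] at h
    exact h
  -- each fixed-length term is integrable
  have iN : ∀ N, Integrable (fun φ => (χ φ - c) * hmcOpPhi4 J lam δ N (fun ψ => χ ψ - c) φ
      * gibbsWeight J lam φ) := fun N =>
    bddObs_integrable_mul_mul_gibbsWeight one_pos hco hg
      (bddObs_hmcOpOf J lam (measurable_hmcProposal J lam δ N) hg)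
  -- `∫ g (K̄ g) w = Σ w_N ∫ g (K_N g) w`
  have hsum : ∫ φ, (χ φ - c) * hmcOpRandom J lam δ S w (fun ψ => χ ψ - c) φ * gibbsWeight J lam φ
      = ∑ N ∈ S, w N * ∫ φ, (χ φ - c) * hmcOpPhi4 J lam δ N (fun ψ => χ ψ - c) φ
          * gibbsWeight J lam φ := by
    have e : ∀ φ, (χ φ - c) * hmcOpRandom J lam δ S w (fun ψ => χ ψ - c) φ * gibbsWeight J lam φ
        = ∑ N ∈ S, w N * ((χ φ - c) * hmcOpPhi4 J lam δ N (fun ψ => χ ψ - c) φ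
          * gibbsWeight J lam φ) := by
      intro φ
      unfold hmcOpRandom
      rw [Finset.mul_sum, Finset.sum_mul]
      exact Finset.sum_congr rfl fun N _ => by ring
    simp_rw [e]
    rw [integral_finsetSum _ fun N _ => (iN N).const_mul (w N)]
    exact Finset.sum_congr rfl fun N _ => integral_const_mul _ _
  -- the fixed-length Dirichlet bounds, averaged with the weights
  have hN : ∀ N ∈ S, (∫ φ, (χ φ - c) ^ 2 * gibbsWeight J lam φ)
      - ∫ φ, (χ φ - c) * hmcOpPhi4 J lam δ N (fun ψ => χ ψ - c) φ * gibbsWeight J lam φ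
      ≤ ε * ∫ φ, χ φ * gibbsWeight J lam φ := fun N hNS =>
    hmc_dirichlet_indicator_le hlam J δ N hχ h01 (hacc N hNS) c
  set P := ∫ φ, (χ φ - c) ^ 2 * gibbsWeight J lam φ with hP
  set E := ε * ∫ φ, χ φ * gibbsWeight J lam φ with hE
  rw [hsum]
  have hPsum : P = ∑ N ∈ S, w N * P := by rw [← Finset.sum_mul, hw1, one_mul]
  have hEsum : E = ∑ N ∈ S, w N * E := by rw [← Finset.sum_mul, hw1, one_mul]
  rw [hPsum, ← Finset.sum_sub_distrib]
  calc ∑ N ∈ S, (w N * P - w N * ∫ φ, (χ φ - c) * hmcOpPhi4 J lam δ N (fun ψ => χ ψ - c) φ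
        * gibbsWeight J lam φ)
      ≤ ∑ N ∈ S, w N * E := by
        refine Finset.sum_le_sum fun N hNS => ?_
        rw [← mul_sub]
        exact mul_le_mul_of_nonneg_left (hN N hNS) (hw0 N)
    _ = E := hEsum.symm

/-- **RANDOMISED-LENGTH HMC FOR LATTICE φ⁴ HAS NO SPECTRAL GAP.**  Every `λ > 0`, real `J`, `δ > 0`,
every finite set `S` of positive trajectory lengths with weights `w ≥ 0`, `Σ_{N∈S} w_N = 1`
(`K̄ = hmcOpRandom J λ δ S w`).  For every `ε > 0` there is `t ≥ 1` such that the centred indicator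
`g = χ_t − ⟨χ_t⟩` of the box `A_t` satisfies `∫ g² e^{−S} > 0` and
`ρ_g(1) = ∫ g (K̄ g) e^{−S} / ∫ g² e^{−S} ≥ 1 − ε`. -/
theorem hmcRandom_no_spectral_gap {lam δ : ℝ} (hlam : 0 < lam) (hδ : 0 < δ)
    (J : Fin (n + 1) → Fin (n + 1) → ℝ) (S : Finset ℕ) (hS : ∀ N ∈ S, 1 ≤ N) {w : ℕ → ℝ}
    (hw0 : ∀ N, 0 ≤ w N) (hw1 : ∑ N ∈ S, w N = 1) {ε : ℝ} (hε : 0 < ε) :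
    ∃ t : ℝ, 1 ≤ t ∧
      0 < ∫ φ, ((if (∀ x, t ≤ φ x ∧ φ x ≤ 2 * t) then (1 : ℝ) else 0)
          - gibbsExpect J lam (fun ψ => if (∀ x, t ≤ ψ x ∧ ψ x ≤ 2 * t) then (1 : ℝ) else 0)) ^ 2
          * gibbsWeight J lam φ ∧
      1 - ε ≤ (∫ φ, ((if (∀ x, t ≤ φ x ∧ φ x ≤ 2 * t) then (1 : ℝ) else 0)
          - gibbsExpect J lam (fun ψ => if (∀ x, t ≤ ψ x ∧ ψ x ≤ 2 * t) then (1 : ℝ) else 0))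
        * hmcOpRandom J lam δ S w (fun ψ => (if (∀ x, t ≤ ψ x ∧ ψ x ≤ 2 * t) then (1 : ℝ) else 0)
          - gibbsExpect J lam (fun ψ => if (∀ x, t ≤ ψ x ∧ ψ x ≤ 2 * t) then (1 : ℝ) else 0)) φ
        * gibbsWeight J lam φ)
        / ∫ φ, ((if (∀ x, t ≤ φ x ∧ φ x ≤ 2 * t) then (1 : ℝ) else 0)
          - gibbsExpect J lam (fun ψ => if (∀ x, t ≤ ψ x ∧ ψ x ≤ 2 * t) then (1 : ℝ) else 0)) ^ 2
          * gibbsWeight J lam φ := by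
  have hco := latticePhi4Action_coercive hlam J
  have hZ := gibbsZ_pos hlam J
  set M₂ := ∫ φ : Fin (n + 1) → ℝ, φ 0 ^ 2 * gibbsWeight J lam φ with hM₂
  have hM₂0 : 0 ≤ M₂ := integral_nonneg fun φ => mul_nonneg (sq_nonneg _) (gibbsWeight_pos J lam φ).le
  -- one threshold for all lengths in `S`, then `t` beyond it and beyond `1 + 2M₂/Z`
  obtain ⟨T, hT, hall⟩ := hmcPhi4_accept_le_of_mem_box_finset hlam hδ J (half_pos hε) S hS
  set t : ℝ := max T (1 + 2 * M₂ / gibbsZ J lam) with htdef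
  have htT : 1 + 2 * M₂ / gibbsZ J lam ≤ t := le_max_right _ _
  have ht1 : 1 ≤ t := le_trans hT (le_max_left _ _)
  have ht0 : 0 < t := by linarith
  refine ⟨t, ht1, ?_⟩
  set χ : (Fin (n + 1) → ℝ) → ℝ := fun φ => if (∀ x, t ≤ φ x ∧ φ x ≤ 2 * t) then (1 : ℝ) else 0
    with hχdef
  have hχ : BddObs χ := boxInd_bddObs t
  have h01 : ∀ φ, χ φ = 0 ∨ χ φ = 1 := fun φ => by
    rw [hχdef]; dsimp only; split_ifs
    · exact Or.inr rfl
    · exact Or.inl rfl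
  set a := gibbsExpect J lam χ with ha
  set I := ∫ φ, χ φ * gibbsWeight J lam φ with hI
  have hIpos : 0 < I := integral_boxInd_pos hlam J ht0
  have hIle : I ≤ 1 / t ^ 2 * M₂ := integral_boxInd_le hlam J ht0
  have haI : a * gibbsZ J lam = I := by
    rw [ha, hI]; unfold gibbsExpect; exact div_mul_cancel₀ _ hZ.ne'
  have ha0 : 0 < a := by
    rw [ha]; unfold gibbsExpect; exact div_pos hIpos hZ
  have hahalf : a ≤ 1 / 2 := by
    have ht2 : 2 * M₂ / gibbsZ J lam ≤ t ^ 2 := by nlinarith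
    have h1 : 2 * M₂ ≤ t ^ 2 * gibbsZ J lam := by
      rw [div_le_iff₀ hZ] at ht2; linarith
    have h2 : I * t ^ 2 ≤ M₂ := by
      have := hIle
      rw [one_div, ← div_eq_inv_mul, le_div_iff₀ (by positivity)] at this
      linarith
    have h3 : a * gibbsZ J lam * t ^ 2 ≤ M₂ := by rw [haI]; exact h2
    have ht2pos : 0 < t ^ 2 := by positivity
    nlinarith [mul_pos hZ ht2pos]
  have hP : ∫ φ, (χ φ - a) ^ 2 * gibbsWeight J lam φ = (1 - a) * I :=
    integral_indicator_var hlam J hχ h01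
  have hPpos : 0 < (1 - a) * I := mul_pos (by linarith) hIpos
  have hacc' : ∀ N ∈ S, ∀ φ, χ φ = 1 →
      (∫ p, involAccept (phi4HmcEnergy J lam) (hmcProposal J lam δ N) (φ, p) * momentumWeight p)
          / momentumZ n ≤ ε / 2 := by
    intro N hNS φ hφ
    refine hall N hNS t (le_max_left _ _) φ ?_
    by_contra hnot
    have : χ φ = 0 := by rw [hχdef]; dsimp only; rw [if_neg hnot]
    rw [this] at hφ
    exact zero_ne_one hφ
  have hdir := hmcRandom_dirichlet_indicator_le hlam J δ S hw0 hw1 hχ h01 hacc' a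
  refine ⟨by rw [hP]; exact hPpos, ?_⟩
  rw [hP] at hdir ⊢
  rw [le_div_iff₀ hPpos]
  have h1a : 1 / 2 ≤ 1 - a := by linarith
  nlinarith [mul_nonneg hε.le hIpos.le]

end RandomNoGap

end Summit.Ventures.LatticeQCDFlow.Exactness
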